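import Summits.ValiantsHypothesis.ValiantsHypothesis.Theorems.SymPencilPerFourTwoRowsRadical
import Literature.Computability.AlgebraicComplexity.PerStabilizerMarcusMay

/-!
# Route `SymPencil` — transport of JOINT square families under the symmetries of `per_4`
# (`--supports` stmt-ValiantsHypothesis-5674 `SdcSuperquadratic`; glue for the V-side bricks of
# the size-`27` cell `(11, 5, 4)`)

The V-side bricks `SymPencilPerFourCrossPairNoJoint`, `…RowPairNoJoint`, `…RowPairSkewNoJoint`,
`…RowPairSumNoJoint` exclude a JOINT bilinear family of four squares on every subspace `V`
containing two specific NORMALISED generators.  To apply them to a general `V` one moves `V`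
by a symmetry of `per_4` — row/column permutations, transposition, and the torus
`y ↦ (rᵢ cⱼ yᵢⱼ)` — onto a normalised position.  This file supplies the transport:

* `jointFamily_map`: if `Φ` is a linear automorphism of `K^{4×4}` with
  `per_4 (Φ z) = χ · per_4 (z)` for all `z`, a joint family `(c, β)` of `d` squares on `V`
  yields the joint family `(χ c, β ∘ (Φ⁻¹ × Φ⁻¹))` on `Φ(V)`;
* the three instances `jointFamily_map_prodCongr` (row/column permutations, `χ = 1`,
  `SymPencilPerFourBlocks.eval_perPoly_comp_prodCongr`), `jointFamily_map_transpose`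
  (`χ = 1`, `SymPencilPerFourTwoRowsRadical.eval_perPoly_transpose`) and `jointFamily_map_torus`
  (`χ = ∏ rᵢ ∏ cⱼ`, Marcus–May / Minc row and column scaling
  `Literature…MarcusMay.permanent_diagonal_mul`, `permanent_mul_diagonal`);
* the contrapositive `not_jointFamily_of_map`: no joint family on `Φ(V)` ⇒ none on `V`.

(The one-sided analogues are `SymPencilPerFourCoordinateRadical.sqFamily_map` and
`SymPencilPerFourLowRankSeven.sqFamilySwap_map`.)  Honest framing: glue only; `27 ≤ sdc(per₄) ≤ 29`
unchanged, the crux `SdcSuperquadratic` and `VP ≠ VNP` untouched.  No definitions, no named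
facts. [folklore]
-/

noncomputable section

-- single-conjunct layout: Sub = Summit, duplicated namespace component intended
set_option linter.dupNamespace false

namespace Summit.ValiantsHypothesis.ValiantsHypothesis.Theorems.SymPencilPerFourJointFamilyTransport

open MvPolynomial Module Matrix
open Literature.Computability.AlgebraicComplexity
open Summit.ValiantsHypothesis.ValiantsHypothesis.Theorems.SymPencilPerFourBlocks
open Summit.ValiantsHypothesis.ValiantsHypothesis.Theorems.SymPencilPerFourTwoRowsRadical

variable {K : Type*} [Field K]

/-- **Transport of a joint family along a `per_4`-semi-invariant linear automorphism.**  If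
`per_4 (Φ z) = χ per_4 (z)` for all `z`, a joint family of `d` squares on `V` gives one on
`Φ(V)`. [folklore] -/
theorem jointFamily_map {d : ℕ} (V : Submodule K (Fin 4 × Fin 4 → K))
    (Φ : (Fin 4 × Fin 4 → K) ≃ₗ[K] (Fin 4 × Fin 4 → K)) (χ : K)
    (hΦ : ∀ z, eval (Φ z) (perPoly (Fin 4) K) = χ * eval z (perPoly (Fin 4) K))
    (c : Fin d → K) (β : Fin d → ((Fin 4 × Fin 4 → K) →ₗ[K] (Fin 4 × Fin 4 → K) →ₗ[K] K))
    (h : ∀ u : Fin 4 × Fin 4 → K, ∀ x ∈ V, ∃ e₀ e₁ : K, ∀ s : K,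
      eval (u + s • x) (perPoly (Fin 4) K) = e₀ + s * e₁ + s ^ 2 * ∑ k, c k * (β k u x) ^ 2) :
    ∃ (c' : Fin d → K) (β' : Fin d → ((Fin 4 × Fin 4 → K) →ₗ[K] (Fin 4 × Fin 4 → K) →ₗ[K] K)),
      ∀ u : Fin 4 × Fin 4 → K, ∀ y ∈ V.map Φ.toLinearMap, ∃ e₀ e₁ : K, ∀ s : K,
        eval (u + s • y) (perPoly (Fin 4) K) = e₀ + s * e₁ + s ^ 2 * ∑ k, c' k * (β' k u y) ^ 2 := by
  refine ⟨fun k => χ * c k,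
    fun k => ((β k).comp Φ.symm.toLinearMap).compl₂ Φ.symm.toLinearMap, fun u => ?_⟩
  rintro _ ⟨x, hx, rfl⟩
  obtain ⟨e₀, e₁, he⟩ := h (Φ.symm u) x hx
  refine ⟨χ * e₀, χ * e₁, fun s => ?_⟩
  have hu : u + s • Φ.toLinearMap x = Φ (Φ.symm u + s • x) := by
    rw [map_add, map_smul, LinearEquiv.apply_symm_apply]; rfl
  rw [hu, hΦ, he s]
  simp only [LinearMap.compl₂_apply, LinearMap.comp_apply, LinearEquiv.coe_coe,
    LinearEquiv.symm_apply_apply]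
  have hsum : ∑ k, χ * c k * (β k (Φ.symm u) x) ^ 2 = χ * ∑ k, c k * (β k (Φ.symm u) x) ^ 2 := by
    rw [Finset.mul_sum]
    exact Finset.sum_congr rfl fun k _ => by ring
  rw [hsum]
  ring

/-- **Contrapositive form.**  If `Φ(V)` carries no joint family of `d` squares, neither does `V`.
[folklore] -/
theorem not_jointFamily_of_map {d : ℕ} (V : Submodule K (Fin 4 × Fin 4 → K))
    (Φ : (Fin 4 × Fin 4 → K) ≃ₗ[K] (Fin 4 × Fin 4 → K)) (χ : K)
    (hΦ : ∀ z, eval (Φ z) (perPoly (Fin 4) K) = χ * eval z (perPoly (Fin 4) K))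
    (hno : ∀ (c' : Fin d → K)
      (β' : Fin d → ((Fin 4 × Fin 4 → K) →ₗ[K] (Fin 4 × Fin 4 → K) →ₗ[K] K)),
      ¬ (∀ u : Fin 4 × Fin 4 → K, ∀ y ∈ V.map Φ.toLinearMap, ∃ e₀ e₁ : K, ∀ s : K,
        eval (u + s • y) (perPoly (Fin 4) K) = e₀ + s * e₁ + s ^ 2 * ∑ k, c' k * (β' k u y) ^ 2))
    (c : Fin d → K) (β : Fin d → ((Fin 4 × Fin 4 → K) →ₗ[K] (Fin 4 × Fin 4 → K) →ₗ[K] K)) :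
    ¬ (∀ u : Fin 4 × Fin 4 → K, ∀ x ∈ V, ∃ e₀ e₁ : K, ∀ s : K,
      eval (u + s • x) (perPoly (Fin 4) K) = e₀ + s * e₁ + s ^ 2 * ∑ k, c k * (β k u x) ^ 2) := by
  intro h
  obtain ⟨c', β', h'⟩ := jointFamily_map V Φ χ hΦ c β h
  exact hno c' β' h'

/-- **Row/column permutations.**  `Φ z = z ∘ (σ × τ)` (`χ = 1`). [folklore] -/
theorem jointFamily_map_prodCongr {d : ℕ} (V : Submodule K (Fin 4 × Fin 4 → K))
    (σ τ : Equiv.Perm (Fin 4))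
    (c : Fin d → K) (β : Fin d → ((Fin 4 × Fin 4 → K) →ₗ[K] (Fin 4 × Fin 4 → K) →ₗ[K] K))
    (h : ∀ u : Fin 4 × Fin 4 → K, ∀ x ∈ V, ∃ e₀ e₁ : K, ∀ s : K,
      eval (u + s • x) (perPoly (Fin 4) K) = e₀ + s * e₁ + s ^ 2 * ∑ k, c k * (β k u x) ^ 2) :
    ∃ (c' : Fin d → K) (β' : Fin d → ((Fin 4 × Fin 4 → K) →ₗ[K] (Fin 4 × Fin 4 → K) →ₗ[K] K)),
      ∀ u : Fin 4 × Fin 4 → K,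
        ∀ y ∈ V.map (LinearEquiv.funCongrLeft K K (Equiv.prodCongr σ τ)).toLinearMap,
        ∃ e₀ e₁ : K, ∀ s : K,
          eval (u + s • y) (perPoly (Fin 4) K) = e₀ + s * e₁ + s ^ 2 * ∑ k, c' k * (β' k u y) ^ 2 :=
  jointFamily_map V _ 1 (fun z => by
    rw [one_mul]
    exact eval_perPoly_comp_prodCongr σ τ z) c β h

/-- **Transposition.**  `Φ z = zᵀ` (`χ = 1`). [folklore] -/
theorem jointFamily_map_transpose {d : ℕ} (V : Submodule K (Fin 4 × Fin 4 → K))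
    (c : Fin d → K) (β : Fin d → ((Fin 4 × Fin 4 → K) →ₗ[K] (Fin 4 × Fin 4 → K) →ₗ[K] K))
    (h : ∀ u : Fin 4 × Fin 4 → K, ∀ x ∈ V, ∃ e₀ e₁ : K, ∀ s : K,
      eval (u + s • x) (perPoly (Fin 4) K) = e₀ + s * e₁ + s ^ 2 * ∑ k, c k * (β k u x) ^ 2) :
    ∃ (c' : Fin d → K) (β' : Fin d → ((Fin 4 × Fin 4 → K) →ₗ[K] (Fin 4 × Fin 4 → K) →ₗ[K] K)),
      ∀ u : Fin 4 × Fin 4 → K,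
        ∀ y ∈ V.map (LinearEquiv.funCongrLeft K K (Equiv.prodComm (Fin 4) (Fin 4))).toLinearMap,
        ∃ e₀ e₁ : K, ∀ s : K,
          eval (u + s • y) (perPoly (Fin 4) K) = e₀ + s * e₁ + s ^ 2 * ∑ k, c' k * (β' k u y) ^ 2 :=
  jointFamily_map V _ 1 (fun z => by rw [one_mul]; exact eval_perPoly_transpose z) c β h

/-- `per_4` under the torus: `per_4 ((rᵢ cⱼ zᵢⱼ)) = (∏ rᵢ) (∏ cⱼ) per_4 (z)`. [folklore] -/
theorem eval_perPoly_torus (r c : Fin 4 → K) (z : Fin 4 × Fin 4 → K) :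
    eval (fun p : Fin 4 × Fin 4 => r p.1 * c p.2 * z p) (perPoly (Fin 4) K) =
      (∏ i, r i) * (∏ j, c j) * eval z (perPoly (Fin 4) K) := by
  rw [eval_perPoly, eval_perPoly]
  have h : (Matrix.of fun i j => r i * c j * z (i, j)) =
      Matrix.diagonal r * (Matrix.of fun i j => z (i, j)) * Matrix.diagonal c := by
    ext i j
    simp only [Matrix.mul_diagonal, Matrix.diagonal_mul, Matrix.of_apply]
    ring
  rw [h, MarcusMay.permanent_mul_diagonal, MarcusMay.permanent_diagonal_mul]
  ring

/-- **Torus scalings.**  `Φ z = (rᵢ cⱼ zᵢⱼ)` with all `rᵢ, cⱼ ≠ 0` (`χ = ∏ rᵢ ∏ cⱼ`); the image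
`Φ(V)` is described by the descaling condition. [folklore] -/
theorem jointFamily_map_torus {d : ℕ} (V : Submodule K (Fin 4 × Fin 4 → K))
    (r c : Fin 4 → K) (hr : ∀ i, r i ≠ 0) (hc : ∀ j, c j ≠ 0)
    (cc : Fin d → K) (β : Fin d → ((Fin 4 × Fin 4 → K) →ₗ[K] (Fin 4 × Fin 4 → K) →ₗ[K] K))
    (h : ∀ u : Fin 4 × Fin 4 → K, ∀ x ∈ V, ∃ e₀ e₁ : K, ∀ s : K,
      eval (u + s • x) (perPoly (Fin 4) K) = e₀ + s * e₁ + s ^ 2 * ∑ k, cc k * (β k u x) ^ 2) :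
    ∃ (c' : Fin d → K) (β' : Fin d → ((Fin 4 × Fin 4 → K) →ₗ[K] (Fin 4 × Fin 4 → K) →ₗ[K] K)),
      ∀ u : Fin 4 × Fin 4 → K, ∀ y : Fin 4 × Fin 4 → K,
        (fun p : Fin 4 × Fin 4 => (r p.1)⁻¹ * (c p.2)⁻¹ * y p) ∈ V →
        ∃ e₀ e₁ : K, ∀ s : K,
          eval (u + s • y) (perPoly (Fin 4) K) = e₀ + s * e₁ + s ^ 2 * ∑ k, c' k * (β' k u y) ^ 2 := by
  -- the torus as a linear automorphism
  let Φ : (Fin 4 × Fin 4 → K) ≃ₗ[K] (Fin 4 × Fin 4 → K) :=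
    LinearEquiv.piCongrRight fun p : Fin 4 × Fin 4 =>
      LinearEquiv.smulOfNeZero K K (r p.1 * c p.2) (mul_ne_zero (hr p.1) (hc p.2))
  have hΦ : ∀ z p, Φ z p = r p.1 * c p.2 * z p := fun z p => by
    simp only [Φ, LinearEquiv.piCongrRight_apply, LinearEquiv.smulOfNeZero_apply, smul_eq_mul]
  have hper : ∀ z, eval (Φ z) (perPoly (Fin 4) K) =
      ((∏ i, r i) * ∏ j, c j) * eval z (perPoly (Fin 4) K) := by
    intro z
    have hz : (Φ z : Fin 4 × Fin 4 → K) = fun p => r p.1 * c p.2 * z p := funext (hΦ z)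
    rw [hz, eval_perPoly_torus]
  obtain ⟨c', β', h'⟩ := jointFamily_map V Φ _ hper cc β h
  refine ⟨c', β', fun u y hy => h' u y ?_⟩
  refine ⟨fun p => (r p.1)⁻¹ * (c p.2)⁻¹ * y p, hy, ?_⟩
  funext p
  rw [LinearEquiv.coe_coe, hΦ]
  field_simp [hr p.1, hc p.2]

end Summit.ValiantsHypothesis.ValiantsHypothesis.Theorems.SymPencilPerFourJointFamilyTransport

end
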